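import Literature.IUT.LogVolume.GenuineLogThetaPointNecessity
import Mathlib.Tactic.IntervalCases
import HarnessLib

/-!
# [IUTchIV] Thm. 1.10 p. 22 "`l ≠ 5`" AT A GENUINE Θ-VOLUME DATUM: the datum forces `7 ≤ l`

Mochizuki, *Inter-universal Teichmüller theory IV*, RIMS manuscript (Apr. 2020; = PRIMS **57** (2021)), Thm. 1.10, p. 22:
"`l ≠ 5`"; proof of Cor. 2.2 (ii), p. 45–46: the (P1) prime is `≥ √h`. Proof-only sequel (cell `abc-iut`, seat
abc-iut-f-198; FACT-LIST row F-2786 `Cor22.ThetaDataExistsAt`) of `GenuineLogThetaPointNecessity.lean`.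

In the kernel: the datum's "`(3·5)`-torsion rational over `F`" (`Cor22.ThetaVolumeDatumAt.torsion_thirty_rational`,
Thm. 1.10 p. 22) and [IUTchI] Def. 3.1 (c) "the image of `G_F → GL₂(𝔽_l)` contains `SL₂(𝔽_l)`"
(`InitialThetaData.imageContainsSL2`) are jointly unsatisfiable when `l ∣ 30`: the unipotent `(1 1; 0 1)` must be a
Galois element, yet every `σ ∈ G_F` fixes the rational `l`-torsion (the argument of abc-iut's
`ArithInput.not_dvd_thirty`, `InitialThetaDataArith.lean`, there over `AlgebraicClosure F`; here over the datum's own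
`F̄`). Hence every genuine datum has `7 ≤ l` (`ThetaVolumeDatumAt.seven_le`), `ThetaDataExistsAt P 5` fails at EVERY
point (`not_thetaDataExistsAt_five`), and the registered stub (i) `ThetaPartII.stub_thetaData` is vacuous at `l = 5`
(its binders `P ∈ UP, AdmitsCore P, CondP2 P 5, CondP5 P 5, CondP6 P 5` are then jointly unsatisfiable); the sharpened
necessity reading of F-2786 is `thetaDataExistsAt_imp_seven_le : ThetaDataExistsAt P l → l.Prime ∧ 7 ≤ l ∧ P.InU ∧
CondP5 P l`. Classical; nothing here constructs a datum or bears on [IUTchIII] Cor. 3.12; no side is taken.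
[cite: Mochizuki2012, IUTchIV Thm. 1.10 p. 22] [claim: Mochizuki2012, status: disputed] for every IUT quotation.
-/

noncomputable section

open scoped Classical

namespace Literature.IUT.LogVolume

namespace Cor22

open NumberField IsDedekindDomain Literature.IUT.HodgeTheaters
open Literature.NumberTheory.DiophantineGeometry.GenEll

namespace ThetaVolumeDatumAt

variable {P : NFPoint} {l : ℕ}

/-- **A genuine Θ-volume datum has `l ∤ 30`**: the `30`-torsion of `E_F` is `F`-rational (Thm. 1.10, p. 22), so every
`σ ∈ G_F` fixes `E_F[l](F̄)` when `l ∣ 30`; but by Def. 3.1 (c) the unipotent `(1 1; 0 1) ∈ SL₂(𝔽_l)` is realised by some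
`σ`, which moves the second basis vector. [cite: Mochizuki2012, IUTchIV Thm. 1.10 p. 22]
[cite: Mochizuki2012, IUTchI Def. 3.1 (c) p. 62] -/
theorem not_dvd_thirty (T : ThetaVolumeDatumAt P l) : ¬ l ∣ 30 := by
  letI := T.instFieldF; letI := T.instNumberFieldF; letI := T.instAlgebraF; letI := T.instFieldK
  letI := T.instNumberFieldK; letI := T.instAlgebraK; letI := T.instFieldFbar; letI := T.instAlgebraFbar
  letI := T.instAlgebraKFbar; letI := T.instIsElliptic
  intro hl
  have hl' : (l : ℤ) ∣ 30 := by exact_mod_cast hl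
  obtain ⟨B, Q, -, hQ, hindep, -, hreal⟩ := T.D.imageContainsSL2.exists_basis
  -- the unipotent matrix `(a b; c d) = (1 1; 0 1)`
  obtain ⟨σ, -, hσQ⟩ := hreal 1 1 0 1 (by norm_num)
  -- every `σ ∈ G_F` fixes the rational `l`-torsion point `Q`
  have h30 : (30 : ℤ) • Q = 0 := by
    obtain ⟨k, hk⟩ := hl'
    rw [hk, mul_comm, mul_smul, hQ, smul_zero]
  have hfix : galoisAct T.E σ Q = Q := by
    obtain ⟨Q₀, hQ₀⟩ := T.torsion_thirty_rational Q h30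
    rw [← hQ₀, galoisAct]
    exact WeierstrassCurve.Affine.Point.map_baseChange (σ : T.Fbar →ₐ[T.F] T.Fbar) Q₀
  rw [hfix] at hσQ
  simp only [one_smul] at hσQ
  -- so the first basis vector vanishes, contradicting independence
  have hB0 : B = 0 := by
    have h := congrArg (· - Q) hσQ
    simpa using h.symm
  have h1 : (l : ℤ) ∣ 1 := (hindep 1 0 (by rw [hB0]; simp)).1
  have hl5 : (5 : ℤ) ≤ l := by exact_mod_cast T.prime_and_five_le.2
  have := Int.le_of_dvd one_pos h1
  omega

/-- `l ≠ 5` at a genuine datum. [cite: Mochizuki2012, IUTchIV Thm. 1.10 p. 22] -/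
theorem l_ne_five (T : ThetaVolumeDatumAt P l) : l ≠ 5 := by
  rintro rfl
  exact T.not_dvd_thirty (by norm_num)

/-- **`7 ≤ l` at a genuine Θ-volume datum** (`l` prime, `l ≥ 5` by Def. 3.1 (c), `l ≠ 5` by the rational `15`-torsion):
the `l`-side necessary condition of F-2786 sharpened from abc-iut-w5-d239's `5 ≤ l`. [cite: Mochizuki2012, IUTchIV Thm. 1.10 p. 22] -/
theorem seven_le (T : ThetaVolumeDatumAt P l) : 7 ≤ l := by
  obtain ⟨hprime, h5⟩ := T.prime_and_five_le
  have hnd := T.not_dvd_thirty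
  rcases Nat.lt_or_ge l 7 with hlt | hge
  · interval_cases l
    · exact absurd (by norm_num) hnd
    · exact absurd hprime (by norm_num)
  · exact hge

end ThetaVolumeDatumAt

section ExistsSevenLe

variable {P : NFPoint} {l : ℕ}

/-- **What `ThetaDataExistsAt P l` forces on `(P, l)`, sharpened**: `l` prime `≥ 7`, `λ ∈ U_X`, and (P5).
[cite: Mochizuki2012, IUTchIV Cor. 2.2 (ii) proof p. 46] [cite: Mochizuki2012, IUTchIV Thm. 1.10 p. 22] -/
theorem thetaDataExistsAt_imp_seven_le (h : ThetaDataExistsAt P l) : l.Prime ∧ 7 ≤ l ∧ P.InU ∧ CondP5 P l := by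
  obtain ⟨T⟩ := h
  exact ⟨T.prime_and_five_le.1, T.seven_le, T.inU, T.condP5⟩

/-- For `l < 7` there is NO genuine Θ-volume datum at `(P, l)`, whatever `P`. [cite: Mochizuki2012, IUTchIV Thm. 1.10 p. 22] -/
theorem not_thetaDataExistsAt_of_lt_seven (hl : l < 7) : ¬ ThetaDataExistsAt P l :=
  fun h => absurd (thetaDataExistsAt_imp_seven_le h).2.1 (not_le.mpr hl)

/-- **`ThetaDataExistsAt P 5` fails at EVERY point** — although `l = 5` satisfies [IUTchI] Def. 3.1 (c)'s "`l ≥ 5` prime":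
with the `(3·5)`-torsion rational (Thm. 1.10) no Galois element can realise a non-trivial unipotent on `E[5]`. In
particular the registered stub (i) `ThetaPartII.stub_thetaData` (binders `… l.Prime → 5 ≤ l → …`) is VACUOUS at `l = 5`:
its remaining binders are then jointly unsatisfiable. [cite: Mochizuki2012, IUTchIV Thm. 1.10 p. 22] -/
theorem not_thetaDataExistsAt_five (P : NFPoint) : ¬ ThetaDataExistsAt P 5 :=
  not_thetaDataExistsAt_of_lt_seven (by norm_num)

/-- VACUITY RECORD at `l = 5`: `Cor312AtDatum P 5` holds at every point for want of data.
[cite: Mochizuki2012, IUTchIV Cor. 2.2 (ii) proof p. 46] -/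
theorem cor312AtDatum_five (P : NFPoint) : Cor312AtDatum P 5 :=
  cor312AtDatum_of_not_exists (not_thetaDataExistsAt_five P)

/-- VACUITY RECORD at `l = 5` for the computable half. [cite: Mochizuki2012, IUTchIV Thm. 1.10 Steps (v)–(viii) p. 27–31] -/
theorem hullVolumeAtDatum_five (P : NFPoint) (δ : ℝ) : HullVolumeAtDatum P 5 δ :=
  fun T => absurd rfl T.l_ne_five

/-- **The `l`-side universal closure fails even at admissible-looking `l`**: `¬ ∀ P, ThetaDataExistsAt P 5` in the strong
form `∀ P, ¬ ThetaDataExistsAt P 5` — complementing `not_forall_thetaDataExistsAt_of_prime_five_le` (failure in `P` at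
fixed prime `l ≥ 5`) by failure in `l = 5` at EVERY `P`. [cite: Mochizuki2012, IUTchIV Thm. 1.10 p. 22] -/
theorem not_exists_thetaDataExistsAt_five : ¬ ∃ P : NFPoint, ThetaDataExistsAt P 5 :=
  fun ⟨P, h⟩ => not_thetaDataExistsAt_five P h

end ExistsSevenLe

/-! ## Appendix (same seat, append-only): the CM point `λ = −1 ∈ U_X` — `U_X` and `l ≥ 7` prime do not suffice -/

section HarmonicPoint

/-- `j(−1) = 1728` over `ℚ` (the harmonic cross-ratio; `E_{−1} : y² = x(x−1)(x+1)` has CM by `ℤ[i]`).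
[cite: Mochizuki2012, IUTchIV Cor. 2.2 p. 42] -/
theorem jInv_rat_neg_one : jInv (-1 : ℚ) = 1728 := by
  norm_num [jInv]

/-- `λ = −1` lies in `U_X = ℙ¹ ∖ {0, 1, ∞}`. [cite: Mochizuki2012, IUTchIV Cor. 2.2 p. 42] -/
theorem inU_rat_neg_one : NFPoint.InU { F := ℚ, x := -1 } :=
  ⟨by norm_num, by norm_num⟩

/-- **At the CM point `λ = −1` (presented over `ℚ`, `j = 1728`) there is NO genuine Θ-volume datum, for ANY `l`** —
a point OF `U_X` off the (P5) locus (integral `j`): the `P`-side schema of F-2786 is not an artefact of the cusps.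
[cite: Mochizuki2012, IUTchIV Cor. 2.2 (ii) proof (P5) p. 46] -/
theorem not_thetaDataExistsAt_rat_neg_one (l : ℕ) : ¬ ThetaDataExistsAt { F := ℚ, x := -1 } l := by
  refine not_thetaDataExistsAt_of_isIntegral_jInv ?_
  rw [show jInv ({ F := ℚ, x := -1 } : NFPoint).x = ((1728 : ℤ) : ℚ) by
    exact_mod_cast jInv_rat_neg_one]
  exact isIntegral_algebraMap

/-- **`λ ∈ U_X` and `l` prime `≥ 7` are NOT sufficient for a genuine datum** (witness `λ = −1` over `ℚ`, `l = 7`):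
of the necessary conditions `⟨l.Prime, 7 ≤ l, P.InU, CondP5 P l⟩` the arithmetic one, (P5), is not implied by the
others. [cite: Mochizuki2012, IUTchIV Cor. 2.2 (ii) proof (P5) p. 46] -/
theorem not_forall_thetaDataExistsAt_of_inU_of_seven_le :
    ¬ ∀ (P : NFPoint) (l : ℕ), P.InU → l.Prime → 7 ≤ l → ThetaDataExistsAt P l :=
  fun h => not_thetaDataExistsAt_rat_neg_one 7 (h _ 7 inU_rat_neg_one (by norm_num) le_rfl)

/-- (P5) fails at `λ = −1` over `ℚ` for every `l` (no bad place at all: `j = 1728` is integral).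
[cite: Mochizuki2012, IUTchIV Cor. 2.2 (ii) proof (P5) p. 46] -/
theorem not_condP5_rat_neg_one (l : ℕ) : ¬ CondP5 { F := ℚ, x := -1 } l := by
  rw [condP5_iff_badPlacesAvoid_nonempty, badPlacesAvoid_eq_empty_of_isIntegral]
  · exact Finset.not_nonempty_empty
  · rw [show jInv ({ F := ℚ, x := -1 } : NFPoint).x = ((1728 : ℤ) : ℚ) by
      exact_mod_cast jInv_rat_neg_one]
    exact isIntegral_algebraMap

end HarmonicPoint

end Cor22

end Literature.IUT.LogVolume

end
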